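import Summits.BirchSwinnertonDyer.BirchSwinnertonDyer.Theses.EisensteinPrimes
import Summits.BirchSwinnertonDyer.BirchSwinnertonDyer.Theorems.EisensteinPrimesMazurMCOnCellBTwistbackKnotThmD
import Summits.BirchSwinnertonDyer.BirchSwinnertonDyer.Theorems.EisensteinPrimesMazurMCOnCellBTwistbackValueOfLZZ
import HarnessLib

/-!
# Crux 3 `MazurMCOnCellB` (stmt-BirchSwinnertonDyer-19033), line `twistback`: the knot (p635722) with its ONE typed atom
# discharged from the REFEREED Liu–Zhang–Zhang 2018 fact (width seat x2-p1-w4 g3) — modulo published theorems and ONE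
# preprint (Keller–Yin Thm. D), CRUX 3 ⟺ THE UPPER HALF OF `BSD(p)` ON X2c ∩ `GVPar` (cell `bsd-eis`, LEAD bsd-line-x2-p1 g8)

HONEST FRAMING (cell `bsd-eis`, run/shared/lean/pub/bsd-eis/): one conditional theorem; nothing booked; X2 stays
CONSTRUCTION-SHAPED; no label or count moves; Mazur's main conjecture / BSD is proved for NO curve here. Hypotheses are
NAMED FACTS taken BY NAME: the route's `PublishedInputs`, Poitou–Tate ×2, Hsieh 2014 Thm. 1, Castella JIMJ 17 (2018)
Thms. 2.10–2.11, Liu–Zhang–Zhang Duke 167 (2018) Thms. 1.5.1/1.5.3 (p509230), Mazur 1978 Cor. 4.1, Bump–Friedberg–Hoffstein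
1990 — all PUBLISHED / refereed — and Keller–Yin arXiv:2402.12781v2 Thm. D = Thm. 5.1.3 (UNREFEREED, printed proof gapped at
L1754, flag `KYD-gap`). It is p635722 §5 (`…TwistbackKnotThmD.mazurMCOnCellB_iff_upper_cellC_gvPar_of_thmD_OPEN_of_value3`)
with the value hypothesis `hval3` supplied by `…TwistbackValueOfLZZ.value3_of_thm151_thm153` (x2-p1-w4 g3, over crux 4's
`X2.exists_continuousDisplay_of_lzzRoadInputIoo`). A separate file only because p635722 sits at the 400-line cap.

References: [KellerYin2024] Thm. D = Thm. 5.1.3 (PRE); [LiuZhangZhang2018] Thms. 1.5.1, 1.5.3; [MilneADT2006] Thm. I.7.3;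
[Mazur1978] Cor. 4.1; [JetchevSkinnerWan2017] §7.4; [Miller2011LMS] Def. 1.1; [Wuthrich2014] Thm. 16.
-/

set_option autoImplicit false

-- `Summit.BirchSwinnertonDyer.BirchSwinnertonDyer.…`: the summit and its single sub-problem share a name.
set_option linter.dupNamespace false

noncomputable section

open scoped Classical MatrixGroups ModularForm

open CongruenceSubgroup WeierstrassCurve NumberField
  Literature.NumberTheory.EllipticCurves
  Literature.NumberTheory.EllipticCurves.ModularForms
  Literature.NumberTheory.QuadraticFields
  Literature.NumberTheory.EllipticCurves.Rank1Residual
  Literature.NumberTheory.EllipticCurves.Rank1Residual.Typed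
  Literature.NumberTheory.GaloisCohomology
  Summit.BirchSwinnertonDyer.Rank1Residual
  Summit.BirchSwinnertonDyer.BirchSwinnertonDyer.Theses
  Summit.BirchSwinnertonDyer.BirchSwinnertonDyer.Theorems.EisensteinPrimesMazurMCOnCellBTwistbackKnotThmD

namespace Summit.BirchSwinnertonDyer.BirchSwinnertonDyer.Theorems.EisensteinPrimesMazurMCOnCellBTwistbackKnotLZZ

/-! ## The knot with NO typed atom: the value at `p = 3` from the REFEREED Liu–Zhang–Zhang 2018 fact -/

/-- **`MazurMCOnCellB ↔ (∀ X2c ∩ GVPar, Typed.MissingUpperBoundAt)`, CONDITIONALLY on NAMED FACTS ONLY** — §5 with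
its one typed atom (`hval3`, the BDP value at `𝟙` at `p = 3 ‖ N`) DISCHARGED by width seat x2-p1-w4 g3's
`…TwistbackValueOfLZZ.value3_of_thm151_thm153` from Liu–Zhang–Zhang, Duke Math. J. 167 (2018) Thms. 1.5.1/1.5.3
(`LiuZhangZhang2018.thm151_thm153_modularCurve_heegnerVector`, REFEREED, p509230; crux 4's `X2.exists_continuousDisplay_of_lzzRoadInputIoo`).
Hypotheses BY NAME: `PublishedInputs`; Poitou–Tate ×2, Hsieh 2014 Thm. 1, [cas-split] Thms. 2.10–2.11, LZZ18, Mazur 1978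
Cor. 4.1, BFH 1990 (PUB / refereed); **Keller–Yin Thm. D** (PREPRINT, gapped at L1754) — the ONLY non-refereed input.
READING: modulo published theorems and ONE preprint, Mazur's main conjecture on X2b (row A10) IS the Euler-system half of
`BSD(p)` at the GV-type rank-one multiplicative Eisenstein pairs (row B11 ∩ GVPar). Credits nothing; moves no label.
[claim: KellerYin2024, status: under-review] [cite: KellerYin2024, Thm. D = Thm. 5.1.3 (arXiv:2402.12781v2 L306–L309)]
[cite: LiuZhangZhang2018, Thms. 1.5.1 and 1.5.3] [cite: Miller2011LMS, Def. 1.1] [cite: Wuthrich2014, Thm. 16 (p. 397)] -/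
theorem mazurMCOnCellB_iff_upper_cellC_gvPar_of_thmD_OPEN_of_thm151_thm153 (hP : EisensteinPrimes.PublishedInputs)
    (hPT : ∀ (K : Type) [Field K] [NumberField K], poitouTate_selmerStructure_duality K)
    (hPT2 : ∀ (K : Type) [Field K] [NumberField K], poitouTate_sha_tateDual K)
    (hH : hsieh2014_exists_anticyclotomicPAdicLFunction)
    (hCS : Castella2018Exceptional.thm210_thm211_bdpDisplay_pNew)
    (hLZZ : LiuZhangZhang2018.thm151_thm153_modularCurve_heegnerVector)
    (hD : KellerYin2024.thmD_imcMult_exists_isBDPLFunction_isTorsion_charIdeal_eq_OPEN)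
    (hMaz : mazur_not_dvd_maninConstant_of_odd)
    (hBFH : bumpFriedbergHoffstein_exists_heegnerField_split_twist_simpleZero) :
    EisensteinPrimes.MazurMCOnCellB ↔
      ∀ (W : WeierstrassCurve ℚ) [W.IsElliptic] [W.IsGloballyMinimal] (p : ℕ) [Fact p.Prime],
        X2.CellC W p → GVPar W p → MissingUpperBoundAt W p :=
  mazurMCOnCellB_iff_upper_cellC_gvPar_of_thmD_OPEN_of_value3 hP hPT hPT2 hH hCS hD
    (fun W _ _ p _ N _ K _ _ Dt H w P hp3 hmult hred hr1 hN hK hodd hlt hHN hPt hc ↦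
      EisensteinPrimesMazurMCOnCellBTwistbackValueOfLZZ.value3_of_thm151_thm153 hP.2.2.2.2.2.1
        hP.2.2.2.2.2.2.2.2.1 hLZZ W p N K Dt H w P hp3 hmult hred hr1 hN hK hodd hlt hHN hPt hc)
    hMaz hBFH

end Summit.BirchSwinnertonDyer.BirchSwinnertonDyer.Theorems.EisensteinPrimesMazurMCOnCellBTwistbackKnotLZZ

end
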